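import Mathlib
import Summits.Schanuel.Schanuel.Theorems.RigidCoreSchanuelOnLogFreeCoreSectorGlue
import Summits.Schanuel.Schanuel.Theorems.RigidCoreSchanuelOnLogFreeCoreCalibrationR
import Literature.NumberTheory.Transcendental.GelfondExpLogConjectureProofs

/-!
# Line `sector-split` (v15) of crux `RigidCore.SchanuelOnLogFreeCore`: the Gel'fond ladder cell

Registered stub C7 `stub_diazLadder_coreCell` of line `sector-split` (skeleton v15) of crux
`stmt-Schanuel-0970` (`Summit.Schanuel.Schanuel.Theses.RigidCore.SchanuelOnLogFreeCore`, (R):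
Schanuel's conjecture for `ℚ`-linearly independent tuples drawn from the log-free core
`C_EA = sInf {K ≤ ℂ | 2πi ∈ K, K exp-closed, K relatively algebraically closed}`).

This is BOOKKEEPING for a calibration of (R).  For `β` algebraic of degree `d ≥ 2` over `ℚ` and
`r ∈ ℚ*`, the Gel'fond ladder `x = (β^k · rπi)_{1 ≤ k ≤ d-1}` is

1. a CORE tuple: `β ∈ ℚ̄ ⊆ C_EA`, `r ∈ ℚ ⊆ C_EA`, `πi ∈ C_EA`
   (`CalibrationR.pi_mul_I_mem_logFreeCore`), and `C_EA` is a field;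
2. `ℚ`-free modulo `E = span_ℚ(ℚ̄ ∪ {πi})`: a vanishing rational combination of the classes
   means `∑ₖ cₖ β^{k+1} r · πi = b + q · πi` with `b ∈ ℚ̄`, `q ∈ ℚ`
   (`SectorGlue.exists_eq_add_rat_mul_pi_I_of_mem_span`); the algebraic number
   `s = ∑ₖ cₖ r β^{k+1} − q` then satisfies `s · πi = b ∈ ℚ̄`, so `s = 0` because `πi` is
   transcendental (Lindemann; tree theorem `transcendental_pi_mul_I`);
   `s = 0` is a vanishing `ℚ`-combination of the powers `β^0, β^1, …, β^{d-1}`, which are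
   `ℚ`-linearly independent (`linearIndependent_pow`, `d = deg β`), hence `cₖ r = 0`, i.e.
   `cₖ = 0`.

So the ladder is an (R)-cell of demand `d - 1`, routed wholly to residue 2 of the line by the
sector glue (it is free modulo `E`).  Nothing here is new mathematics and nothing is credited
towards the crux: the file only places the Gel'fond–Diaz cells inside the kernel-checked census
of (R).  All auxiliaries live in the sub-namespace
`Summit.Schanuel.Schanuel.Theorems.RigidCore.DiazLadderCell`; only the registered stub
`stub_diazLadder_coreCell` is declared directly in `Summit.Schanuel.Schanuel.Theorems.RigidCore`
(with the crux's `sInf` verbatim; it is `logFreeCore` by `rfl`).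

Sources: the transcendence of `π` (F. Lindemann 1882; A. Baker, *Transcendental Number Theory*
(1975), Ch. 1 Thm 1.3) enters only through the tree theorem
`Literature.NumberTheory.Transcendental.transcendental_pi_mul_I` (`πi` is transcendental, PROVED
over `transcendental_pi_holds`); everything else is Mathlib (`linearIndependent_pow`, `minpoly`)
and the tree's objects `logFreeCore`, `kernelFreeCore` with their API
(`…AclSubsetLogFreeCore.Negative.LogFreeCoreObjects`, `RigidCoreDefs`, `CalibrationB/R`,
`SectorGlue`).  NOT here: Diaz's count on the ladder (stub C6, another file), the two residues of
the line (open problems).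
-/

noncomputable section

namespace Summit.Schanuel.Schanuel.Theorems.RigidCore

open Complex IntermediateField
open Summit.Schanuel.Schanuel.Theorems.AclSubsetLogFreeCore.Negative

namespace DiazLadderCell

/-! ## Helpers -/

/-- An element whose minimal polynomial over `ℚ` has degree at least `n + 1 ≥ 1` is algebraic
(a non-integral element has minimal polynomial `0`). [folklore] -/
theorem isAlgebraic_of_succ_le_natDegree {β : ℂ} {n : ℕ}
    (hn : n + 1 ≤ (minpoly ℚ β).natDegree) : IsAlgebraic ℚ β := by
  refine (minpoly.ne_zero_iff.1 fun h0 => ?_).isAlgebraic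
  rw [h0, Polynomial.natDegree_zero] at hn
  omega

/-- The rungs of the ladder lie in the log-free core: `β^m · (r · πi) ∈ C_EA` for `β` algebraic
and `r ∈ ℚ` (`ℚ̄ ⊆ M ⊆ C_EA`, `πi ∈ C_EA`, and `C_EA` is a field). [folklore] -/
theorem ladder_mem_logFreeCore {β : ℂ} (hβ : IsAlgebraic ℚ β) (r : ℚ) (m : ℕ) :
    β ^ m * ((r : ℂ) * (↑Real.pi * I)) ∈ logFreeCore :=
  mul_mem (pow_mem (CalibrationB.kernelFreeCore_le_logFreeCore
    (mem_kernelFreeCore_of_isAlgebraic_rat hβ)) m)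
    (mul_mem (SubfieldClass.ratCast_mem logFreeCore r) CalibrationR.pi_mul_I_mem_logFreeCore)

/-- If `s · πi = b` with `s, b` algebraic then `s = 0` (otherwise `πi = b / s` would be
algebraic, while `πi` is transcendental: tree theorem
`Literature.NumberTheory.Transcendental.transcendental_pi_mul_I`, Lindemann). [folklore] -/
theorem eq_zero_of_mul_pi_I_mem {s b : ℂ} (hs : s ∈ algebraicClosure ℚ ℂ)
    (hb : b ∈ algebraicClosure ℚ ℂ) (h : s * (↑Real.pi * I) = b) : s = 0 := by
  by_contra hs0
  refine Literature.NumberTheory.Transcendental.transcendental_pi_mul_I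
    (mem_algebraicClosure_iff.1 ?_)
  rw [show (Real.pi : ℂ) * I = b / s from (eq_div_iff hs0).2 (by rw [mul_comm]; exact h)]
  exact div_mem hb hs

/-- **Freeness of the ladder modulo `E = span_ℚ(ℚ̄ ∪ {πi})`.**  If `n + 1 ≤ deg β`, `r ∈ ℚ*`
and `x_k = β^{k+1} · rπi` (`k < n`), then the classes of the `x_k` in `ℂ / E` are `ℚ`-linearly
independent: a relation `∑ c_k x_k ∈ E` reads `(∑ c_k r β^{k+1}) · πi = b + q · πi`
(`b ∈ ℚ̄`, `q ∈ ℚ`), so the algebraic number `∑ c_k r β^{k+1} − q` kills `πi` into `ℚ̄`, hence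
vanishes; this is a vanishing `ℚ`-combination of the linearly independent powers `β^0, …, β^n`
(`linearIndependent_pow`), so `c_k r = 0` and `c_k = 0`. [folklore] -/
theorem ladder_free {β : ℂ} {n : ℕ} (hn : n + 1 ≤ (minpoly ℚ β).natDegree) {r : ℚ}
    (hr : r ≠ 0) (x : Fin n → ℂ)
    (hx : ∀ k, x k = β ^ ((k : ℕ) + 1) * ((r : ℂ) * (↑Real.pi * I))) :
    LinearIndependent ℚ
      ((Submodule.span ℚ ({z : ℂ | IsAlgebraic ℚ z} ∪ {(Real.pi : ℂ) * I})).mkQ ∘ x) := by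
  have hβ : β ∈ algebraicClosure ℚ ℂ :=
    mem_algebraicClosure_iff.2 (isAlgebraic_of_succ_le_natDegree hn)
  rw [Fintype.linearIndependent_iff]
  intro g hg k
  -- the vanishing combination lies in `E`
  have hmem : ∑ i, g i • x i ∈
      Submodule.span ℚ ({z : ℂ | IsAlgebraic ℚ z} ∪ {(Real.pi : ℂ) * I}) := by
    rw [← Submodule.Quotient.mk_eq_zero, ← Submodule.mkQ_apply, map_sum]
    simpa only [map_smul, Function.comp_apply] using hg
  obtain ⟨b, hb, q, hbq⟩ := SectorGlue.exists_eq_add_rat_mul_pi_I_of_mem_span _ hmem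
  -- `∑ g_i x_i = S · πi` with `S = ∑ g_i r β^{i+1}` algebraic
  have hsum : ∑ i, g i • x i =
      (∑ i, (g i : ℂ) * r * β ^ ((i : ℕ) + 1)) * (↑Real.pi * I) := by
    rw [Finset.sum_mul]
    refine Finset.sum_congr rfl fun i _ => ?_
    rw [hx i, Rat.smul_def]
    ring
  have hS : (∑ i, (g i : ℂ) * r * β ^ ((i : ℕ) + 1)) ∈ algebraicClosure ℚ ℂ :=
    sum_mem fun i _ => mul_mem (mul_mem (SubfieldClass.ratCast_mem _ _)
      (SubfieldClass.ratCast_mem _ _)) (pow_mem hβ _)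
  have hrel : (∑ i, (g i : ℂ) * r * β ^ ((i : ℕ) + 1) - q) * (↑Real.pi * I) = b := by
    rw [sub_mul, ← hsum, hbq, add_sub_cancel_right]
  have h0 : ∑ i, (g i : ℂ) * r * β ^ ((i : ℕ) + 1) - q = 0 :=
    eq_zero_of_mul_pi_I_mem (sub_mem hS (SubfieldClass.ratCast_mem _ _)) hb hrel
  -- the powers `β^0, …, β^n` are `ℚ`-linearly independent (`n + 1 ≤ deg β`)
  have hli := (linearIndependent_pow (K := ℚ) β).comp (Fin.castLE hn) (Fin.castLE_injective hn)
  have hk := Fintype.linearIndependent_iff.mp hli (Fin.cons (-q) fun i => g i * r) ?_ k.succ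
  · rw [Fin.cons_succ] at hk
    exact (mul_eq_zero.mp hk).resolve_right hr
  · rw [Fin.sum_univ_succ]
    simp only [Function.comp_apply, Fin.val_castLE, Fin.cons_zero, Fin.cons_succ, Fin.val_zero,
      pow_zero, Fin.val_succ, Rat.smul_def, Rat.cast_neg, Rat.cast_mul]
    linear_combination h0

end DiazLadderCell

/-! ## The registered stub -/

/-- **Registered stub `stub_diazLadder_coreCell` of line `sector-split` (v15, C7; signature
verbatim).**  For `β` with `deg_ℚ β = d ≥ 2`, `r ∈ ℚ*` and the Gel'fond ladder
`x = (β^{k+1} · rπi)_{k < d-1}`: every rung lies in the log-free core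
`C_EA = sInf {K ≤ ℂ | 2πi ∈ K, K exp-closed, K relatively algebraically closed}`
(`β, r, πi ∈ C_EA`), and the classes of the rungs modulo `E = span_ℚ(ℚ̄ ∪ {πi})` are
`ℚ`-linearly independent
(a relation forces a rational polynomial of degree `< d` to vanish at `β`).  So the ladder is an
(R)-cell of demand `d - 1`, routed wholly to residue 2 by the sector glue.  Proof:
`DiazLadderCell.ladder_mem_logFreeCore`, `DiazLadderCell.ladder_free`. [folklore] -/
theorem stub_diazLadder_coreCell :
    ∀ (β : ℂ) (r : ℚ) (d : ℕ), (minpoly ℚ β).natDegree = d → 2 ≤ d → r ≠ 0 →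
      ∀ x : Fin (d - 1) → ℂ,
        (∀ k, x k = β ^ ((k : ℕ) + 1) * ((r : ℂ) * (↑Real.pi * Complex.I))) →
        (∀ k, x k ∈ (sInf {K : IntermediateField ℚ ℂ | (2 * ↑Real.pi * Complex.I : ℂ) ∈ K ∧
          (∀ w ∈ K, Complex.exp w ∈ K) ∧ ∀ w : ℂ, IsAlgebraic K w → w ∈ K} : IntermediateField ℚ ℂ)) ∧
        LinearIndependent ℚ
          ((Submodule.span ℚ ({z : ℂ | IsAlgebraic ℚ z} ∪ {(Real.pi : ℂ) * Complex.I})).mkQ ∘ x) := by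
  intro β r d hd h2 hr x hx
  have hn : d - 1 + 1 ≤ (minpoly ℚ β).natDegree := by omega
  refine ⟨fun k => ?_, DiazLadderCell.ladder_free hn hr x hx⟩
  rw [hx k]
  exact DiazLadderCell.ladder_mem_logFreeCore
    (DiazLadderCell.isAlgebraic_of_succ_le_natDegree hn) r _

end Summit.Schanuel.Schanuel.Theorems.RigidCore

end
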